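import Summits.Ventures.PercRepro.C025ProfileGirthPaving

/-!
# C-025 BELOW THE GIRTH, AND ON EVERY MATROID WHOSE CIRCUITS HAVE `≥ ρ(E) − 1` POINTS (night-3 g21)

The girth theorem of `C025ProfileGirthRowsAll` in the language of circuits: if every circuit of `M` has at least `g`
points (girth `≥ g`), then C-025 holds at every `(p, q)` with `q < g` and every row `(q, u)`, `1 ≤ q < g`, of (Π)
holds.  Since C-025 at `(p, q)` is trivial for `p > ρ(E)` (no set of rank `p`) and for `p ≤ q + 1` (`Φ = 0`), the
only pairs a matroid of girth `g` leaves open have `g ≤ q ≤ ρ(E) − 2`; hence every matroid with girth `≥ ρ(E) − 1`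
— every circuit has at least `ρ(E) − 1` points, one step beyond paving — satisfies C-025 at EVERY `(p, q)`.
* `rls_of_circuits_ge (hg : ∀ C, M.IsCircuit C → g ≤ |C|) (hqg : q < g) (p) : ThmN.RLS M p q`;
* `profileIneq_of_circuits_ge (hg) (hqg : q < g) (hq : 1 ≤ q) (hqu : q < u) : Profile.ProfileIneq M q u`;
* **`rls_of_circuits_ge_eRank_sub_one (h : ∀ C, M.IsCircuit C → M.eRank ≤ |C| + 1) (p q) : ThmN.RLS M p q`** —
  C-025 at every `(p, q)` when every circuit has `≥ ρ(E) − 1` points (`q + 2 ≤ ρ(E)`: girth; `ρ(E) ≤ q + 1`: trivial);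
* `profileIneq_of_circuits_ge_eRank_sub_one` — every row `(q, u)`, `1 ≤ q < u`, in the same regime
  (`u = ρ(E)`: `profileIneq_of_eRank_eq`; `u > ρ(E)`: `profileIneq_of_eRank_lt`);
* **`c025_of_circuits_ge_eRank_sub_one`** — the body of `C025` in its own binders, restricted to that regime.
No `def`, no `instance`, no notation.  Axioms: standard.
-/

open scoped Matroid

namespace PercRepro

open Set Finset

namespace PavingRows

variable {α : Type} [DecidableEq α] {M : Matroid α} [M.Finite]

/-- **C-025 below the girth**: if every circuit has at least `g` points, C-025 holds at every `(p, q)` with `q < g`. -/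
theorem rls_of_circuits_ge {g q : ℕ} (hg : ∀ C, M.IsCircuit C → (g : ℕ∞) ≤ C.encard) (hqg : q < g) (p : ℕ) :
    ThmN.RLS M p q := by
  rcases Nat.eq_zero_or_pos q with rfl | hq
  · exact c025_of_q_zero p
  · exact GirthRows.rls_of_girth_all_rows p q hq (indep_of_encard_le_of_circuits hg hqg)

/-- **Every row of (Π) below the girth**: if every circuit has at least `g` points, the row `(q, u)` holds for
`1 ≤ q < g` and every `u > q`. -/
theorem profileIneq_of_circuits_ge {g q u : ℕ} (hg : ∀ C, M.IsCircuit C → (g : ℕ∞) ≤ C.encard) (hqg : q < g)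
    (hq : 1 ≤ q) (hqu : q < u) : Profile.ProfileIneq M q u :=
  GirthRows.profileIneq_of_girth_all_rows q u hq hqu (indep_of_encard_le_of_circuits hg hqg)

omit [DecidableEq α] [M.Finite] in
/-- In a matroid whose circuits all have at least `ρ(E) − 1` points, every set of at most `q` points with
`q + 2 ≤ ρ(E)` is independent. -/
theorem girth_of_circuits_ge_eRank_sub_one (h : ∀ C, M.IsCircuit C → M.eRank ≤ C.encard + 1) {q : ℕ}
    (hq : ((q : ℕ∞) + 1) < M.eRank) : ∀ T ⊆ M.E, T.encard ≤ (q : ℕ∞) → M.Indep T := by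
  intro T hT hTq
  by_contra hind
  obtain ⟨C, hCT, hC⟩ := ((Matroid.not_indep_iff hT).1 hind).exists_isCircuit_subset
  have h1 : M.eRank ≤ (q : ℕ∞) + 1 :=
    (h C hC).trans (add_le_add ((Set.encard_le_encard hCT).trans hTq) le_rfl)
  exact absurd h1 (not_le.2 hq)

/-- **C-025 at every `(p, q)` on every finite matroid whose circuits all have at least `ρ(E) − 1` points** (one step
beyond paving): for `q + 2 ≤ ρ(E)` every set of at most `q` points is independent and the girth theorem applies; for
`ρ(E) ≤ q + 1` the statement is trivial. -/
theorem rls_of_circuits_ge_eRank_sub_one (h : ∀ C, M.IsCircuit C → M.eRank ≤ C.encard + 1) (p q : ℕ) :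
    ThmN.RLS M p q := by
  rcases Nat.eq_zero_or_pos q with rfl | hq
  · exact c025_of_q_zero p
  by_cases hqr : ((q : ℕ∞) + 1) < M.eRank
  · exact GirthRows.rls_of_girth_all_rows p q hq (girth_of_circuits_ge_eRank_sub_one h hqr)
  · rw [not_lt] at hqr
    by_cases hp : p ≤ q + 1
    · exact rls_of_le_succ p q hp
    · apply ThmN.RLS_of_eRank_lt
      calc M.eRank ≤ (q : ℕ∞) + 1 := hqr
        _ = ((q + 1 : ℕ) : ℕ∞) := by push_cast; rfl
        _ < (p : ℕ∞) := by exact_mod_cast (by omega : q + 1 < p)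

/-- **Every row `(q, u)` of (Π), `1 ≤ q < u`, on every finite matroid whose circuits all have at least `ρ(E) − 1`
points**: `q + 2 ≤ ρ(E)` by the girth theorem; otherwise `u ≥ q + 1 ≥ ρ(E)` and the row is `profileIneq_of_eRank_eq`
(`u = ρ(E)`) or `profileIneq_of_eRank_lt` (`u > ρ(E)`). -/
theorem profileIneq_of_circuits_ge_eRank_sub_one (h : ∀ C, M.IsCircuit C → M.eRank ≤ C.encard + 1) (q u : ℕ)
    (hq : 1 ≤ q) (hqu : q < u) : Profile.ProfileIneq M q u := by
  by_cases hqr : ((q : ℕ∞) + 1) < M.eRank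
  · exact GirthRows.profileIneq_of_girth_all_rows q u hq hqu (girth_of_circuits_ge_eRank_sub_one h hqr)
  · rw [not_lt] at hqr
    have hu : ((q + 1 : ℕ) : ℕ∞) ≤ (u : ℕ∞) := by exact_mod_cast hqu
    rcases lt_or_eq_of_le (hqr.trans (by push_cast at hu ⊢; exact hu)) with hlt | heq
    · exact GirthRows.profileIneq_of_eRank_lt hlt
    · exact GirthRows.profileIneq_of_eRank_eq heq

end PavingRows

/-- **The body of `C025` on every finite matroid whose circuits all have at least `ρ(E) − 1` points**, in the binders
of `C025` itself. -/
theorem c025_of_circuits_ge_eRank_sub_one :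
    ∀ {α : Type} (M : Matroid α) [M.Finite], (∀ C, M.IsCircuit C → M.eRank ≤ C.encard + 1) →
      ∀ (p q : ℕ), q + 2 ≤ p →
      phiK p q * ({A : Set α | A ⊆ M.E ∧ M.eRk A = (p : ℕ∞) ∧ M.eRk (M.E \ A) = (q : ℕ∞)}.ncard : ℚ) ≤
        ({A : Set α | A ⊆ M.E ∧ (q : ℕ∞) < M.eRk A ∧ M.eRk A < (p : ℕ∞)}.ncard : ℚ) := by
  intro α M _ h p q _
  classical
  exact PavingRows.rls_of_circuits_ge_eRank_sub_one h p q

end PercRepro
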